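import Mathlib.Analysis.SpecialFunctions.Gaussian.FourierTransform
import Summits.NavierStokesRegularity.NavierStokesRegularity.Theorems.ClockStretchingLawClockCeilingZoomLimitEnergy
import HarnessLib

/-!
# Route ClockStretchingLaw — crux `ClockCeiling`, line `registered`: continuous convergence of
# the frame form along pointwise limits of Type-I ancient mild fields

Helper file for the lead's stub `stub_zoomCompactness` of the reshaped skeleton of crux
`ClockCeiling` (item stmt-NavierStokesRegularity-10570). The frame form of the four-frame
dichotomy at time `t < 0` and direction `(c₀, b) ∈ ℝ × ℝ³` is
`frame_u(t; c₀, b) = √(-t) ∫ ‖(c₀√(-t)) • ∂ₜu(t,x) + Du(t)(x) b‖² e^{-‖x‖²/(4(-t))} dx`.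
Along a sequence `wₙ → W` of Type-I ancient mild fields whose clock modes `∂ₜwₙ(t,x)` and
translation modes `Dwₙ(t)(x) e` converge pointwise, with the uniform scale-invariant bounds
`‖∂ₜwₙ‖ ≤ K(-t)^{-3/2}`, `‖Dwₙ‖ ≤ K(-t)⁻¹` of `stub_uniformBounds`, the frame form converges
CONTINUOUSLY in the direction: `frame_{wₙ}(t; cₙ, bₙ) → frame_W(t; c₀, b)` whenever
`(cₙ, bₙ) → (c₀, b)` (`tendsto_frame_of_limit`, registered sub-goal `zoomFrame_tendsto`):
dominated convergence with the Gaussian majorant `B² e^{-‖x‖²/(4(-t))}`.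

Also proved here: the clock mode of a jointly smooth field is continuous in space
(`continuous_timeDeriv_slice`: `∂ₜu(t,x) = D(uncurry u)(t,x)(1,0)`), and the Gaussian weight is
integrable on `ℝ³`.

## References

* G. Koch, N. Nadirashvili, G. Seregin, V. Šverák, Acta Math. 203 (2009) = arXiv:0709.3599,
  Lemma 6.1, Prop. 4.1.
-/

set_option linter.dupNamespace false

noncomputable section

open Literature.Analysis.FluidPDE MeasureTheory Set Function Filter Topology Metric
open scoped ENNReal NNReal

namespace Summit.NavierStokesRegularity.NavierStokesRegularity.Theorems

/-! ### Two analytic preliminaries -/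

section Prelim

/-- The Gaussian weight `e^{-‖x‖²/(4(-t))}` of the frame form is integrable on `ℝ³` for `t < 0`
(norm of Mathlib's `GaussianFourier.integrable_cexp_neg_mul_sq_norm_add`). -/
theorem integrable_frameWeight {t : ℝ} (ht : t < 0) :
    Integrable fun x : EuclideanSpace ℝ (Fin 3) => Real.exp (-(‖x‖ ^ 2) / (4 * (-t))) := by
  have hb : 0 < 1 / (4 * (-t)) := by
    have : 0 < -t := neg_pos.2 ht
    positivity
  have h := (GaussianFourier.integrable_cexp_neg_mul_sq_norm_add (V := EuclideanSpace ℝ (Fin 3))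
    (b := (1 / (4 * (-t)) : ℝ)) (by simpa using hb) 0 0).norm
  refine h.congr (Eventually.of_forall fun v => ?_)
  simp only [zero_mul, add_zero, Complex.norm_exp]
  congr 1
  have : -((1 / (4 * (-t)) : ℝ) : ℂ) * (‖v‖ : ℂ) ^ 2 = ((-(‖v‖ ^ 2) / (4 * (-t)) : ℝ) : ℂ) := by
    push_cast; ring
  rw [this, Complex.ofReal_re]

variable {C : ℝ} {v : ℝ → (EuclideanSpace ℝ (Fin 3)) → (EuclideanSpace ℝ (Fin 3))}

/-- **The clock mode is the time component of the total derivative**: for a field jointly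
differentiable at `(t, x)`, `∂ₜv(t,x) = D(uncurry v)(t,x)(1,0)`. -/
theorem timeDeriv_eq_fderiv_uncurry {t : ℝ} {x : EuclideanSpace ℝ (Fin 3)}
    (hd : DifferentiableAt ℝ (uncurry v) (t, x)) :
    timeDeriv v t x = fderiv ℝ (uncurry v) (t, x) ((1 : ℝ), (0 : EuclideanSpace ℝ (Fin 3))) := by
  rw [timeDeriv_apply]
  have hγ : HasDerivAt (fun s : ℝ => ((s, x) : ℝ × (EuclideanSpace ℝ (Fin 3))))
      ((1 : ℝ), (0 : EuclideanSpace ℝ (Fin 3))) t :=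
    (hasDerivAt_id t).prodMk (hasDerivAt_const t x)
  exact (hd.hasFDerivAt.comp_hasDerivAt t hγ).deriv

/-- **The clock mode of a Type-I ancient mild field is continuous in space** at every negative
time (joint smoothness on the open slab). -/
theorem continuous_timeDeriv_slice (hv : IsTypeIAncientMild C v) {t : ℝ} (ht : t < 0) :
    Continuous fun x => timeDeriv v t x := by
  have hopen : IsOpen (Iio (0 : ℝ) ×ˢ (univ : Set (EuclideanSpace ℝ (Fin 3)))) :=
    isOpen_Iio.prod isOpen_univ
  have hsm := hv.contDiffOn
  have hD : ContinuousOn (fderiv ℝ (uncurry v)) (Iio 0 ×ˢ univ) :=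
    hsm.continuousOn_fderiv_of_isOpen hopen (by simp)
  have hdiff : ∀ x, DifferentiableAt ℝ (uncurry v) (t, x) := fun x =>
    (hsm.differentiableOn (by simp) (t, x) (mk_mem_prod ht (mem_univ x))).differentiableAt
      (hopen.mem_nhds (mk_mem_prod ht (mem_univ x)))
  have heq : (fun x => timeDeriv v t x) = fun x =>
      fderiv ℝ (uncurry v) (t, x) ((1 : ℝ), (0 : EuclideanSpace ℝ (Fin 3))) :=
    funext fun x => timeDeriv_eq_fderiv_uncurry (hdiff x)
  rw [heq]
  have hι : Continuous fun x : EuclideanSpace ℝ (Fin 3) => ((t, x) : ℝ × (EuclideanSpace ℝ (Fin 3))) := by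
    fun_prop
  have hc : Continuous fun x : EuclideanSpace ℝ (Fin 3) => fderiv ℝ (uncurry v) (t, x) :=
    hD.comp_continuous hι fun x => mk_mem_prod ht (mem_univ x)
  exact hc.clm_apply continuous_const

/-- The translation mode `x ↦ Dv(t)(x) b` of a Type-I ancient mild field is continuous. -/
theorem continuous_fderiv_apply_slice (hv : IsTypeIAncientMild C v) {t : ℝ} (ht : t < 0)
    (b : EuclideanSpace ℝ (Fin 3)) : Continuous fun x => fderiv ℝ (v t) x b :=
  ((hv.contDiff_slice ht).continuous_fderiv (by simp)).clm_apply continuous_const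

end Prelim

/-! ### Continuous convergence of the frame form -/

section Frame

variable {C K : ℝ} {w : ℕ → ℝ → (EuclideanSpace ℝ (Fin 3)) → (EuclideanSpace ℝ (Fin 3))}
  {W : ℝ → (EuclideanSpace ℝ (Fin 3)) → (EuclideanSpace ℝ (Fin 3))}

/-- **Continuous convergence of the frame form along a limit of Type-I ancient mild fields.**
If `wₙ, W` are Type-I ancient mild fields, the clock modes `∂ₜwₙ(t,x) → ∂ₜW(t,x)` and the
translation modes `Dwₙ(t)(x) e → DW(t)(x) e` converge pointwise (`t < 0`), and
`‖∂ₜwₙ(t,x)‖ ≤ K(-t)^{-3/2}`, `‖Dwₙ(t)(x)‖ ≤ K(-t)⁻¹` uniformly in `n`, then for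
`(cₙ, bₙ) → (c₀, b)`:
`√(-t)∫‖(cₙ√(-t))•∂ₜwₙ + Dwₙ bₙ‖²ρ_t → √(-t)∫‖(c₀√(-t))•∂ₜW + DW b‖²ρ_t` (dominated convergence,
Gaussian majorant). -/
theorem tendsto_frame_of_limit (hw : ∀ n, IsTypeIAncientMild C (w n)) (hW : IsTypeIAncientMild C W)
    (htd : ∀ t < 0, ∀ x, Tendsto (fun n => timeDeriv (w n) t x) atTop (𝓝 (timeDeriv W t x)))
    (hfd : ∀ t < 0, ∀ x e, Tendsto (fun n => fderiv ℝ (w n t) x e) atTop (𝓝 (fderiv ℝ (W t) x e)))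
    (h1t : ∀ n, ∀ t < 0, ∀ x, ‖timeDeriv (w n) t x‖ ≤ K * (-t) ^ (-(3 : ℝ) / 2))
    (h1x : ∀ n, ∀ t < 0, ∀ x, ‖fderiv ℝ (w n t) x‖ ≤ K * (-t) ^ (-(1 : ℝ)))
    {t : ℝ} (ht : t < 0) (c₀ : ℝ) (b : EuclideanSpace ℝ (Fin 3)) {c : ℕ → ℝ}
    {b' : ℕ → EuclideanSpace ℝ (Fin 3)} (hc : Tendsto c atTop (𝓝 c₀)) (hb : Tendsto b' atTop (𝓝 b)) :
    Tendsto (fun n => Real.sqrt (-t) * ∫ x, ‖(c n * Real.sqrt (-t)) • timeDeriv (w n) t x +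
        fderiv ℝ (w n t) x (b' n)‖ ^ 2 * Real.exp (-(‖x‖ ^ 2) / (4 * (-t)))) atTop
      (𝓝 (Real.sqrt (-t) * ∫ x, ‖(c₀ * Real.sqrt (-t)) • timeDeriv W t x +
        fderiv ℝ (W t) x b‖ ^ 2 * Real.exp (-(‖x‖ ^ 2) / (4 * (-t))))) := by
  have hK : 0 ≤ K := nonneg_of_gradient_bound (h1x 0)
  have _ := hW
  -- eventual bounds on the directions
  have hcb : ∀ᶠ n in atTop, |c n| < |c₀| + 1 :=
    (continuous_abs.tendsto c₀ |>.comp hc).eventually_lt_const (by linarith)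
  have hbb : ∀ᶠ n in atTop, ‖b' n‖ < ‖b‖ + 1 := hb.norm.eventually_lt_const (by linarith)
  -- the majorant
  set Mc : ℝ := |c₀| + 1 with hMc
  set Mb : ℝ := ‖b‖ + 1 with hMb
  set Bc : ℝ := Mc * Real.sqrt (-t) * (K * (-t) ^ (-(3 : ℝ) / 2)) + K * (-t) ^ (-(1 : ℝ)) * Mb
    with hBc
  -- the integrands
  set F : ℕ → EuclideanSpace ℝ (Fin 3) → ℝ := fun n x => ‖(c n * Real.sqrt (-t)) • timeDeriv (w n) t x +
    fderiv ℝ (w n t) x (b' n)‖ ^ 2 * Real.exp (-(‖x‖ ^ 2) / (4 * (-t))) with hF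
  set f : EuclideanSpace ℝ (Fin 3) → ℝ := fun x => ‖(c₀ * Real.sqrt (-t)) • timeDeriv W t x +
    fderiv ℝ (W t) x b‖ ^ 2 * Real.exp (-(‖x‖ ^ 2) / (4 * (-t))) with hf
  have hgoal : Tendsto (fun n => ∫ x, F n x) atTop (𝓝 (∫ x, f x)) := by
    refine tendsto_integral_filter_of_dominated_convergence
      (fun x => Bc ^ 2 * Real.exp (-(‖x‖ ^ 2) / (4 * (-t)))) ?_ ?_
      ((integrable_frameWeight ht).const_mul _) ?_
    · -- measurability (continuity of the modes in `x`)
      refine Eventually.of_forall fun n => Continuous.aestronglyMeasurable ?_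
      have h1 : Continuous fun x => (c n * Real.sqrt (-t)) • timeDeriv (w n) t x + fderiv ℝ (w n t) x (b' n) :=
        ((continuous_timeDeriv_slice (hw n) ht).const_smul (c n * Real.sqrt (-t))).add
          (continuous_fderiv_apply_slice (hw n) ht (b' n))
      have h2 : Continuous fun x : EuclideanSpace ℝ (Fin 3) => Real.exp (-(‖x‖ ^ 2) / (4 * (-t))) := by
        fun_prop
      exact (h1.norm.pow 2).mul h2
    · -- domination, for the `n` with `|cₙ| ≤ Mc`, `‖bₙ‖ ≤ Mb`
      filter_upwards [hcb, hbb] with n hcn hbn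
      refine Eventually.of_forall fun x => ?_
      have hexp : 0 < Real.exp (-(‖x‖ ^ 2) / (4 * (-t))) := Real.exp_pos _
      have hr1 : 0 ≤ K * (-t) ^ (-(3 : ℝ) / 2) := mul_nonneg hK (Real.rpow_nonneg (neg_pos.2 ht).le _)
      have hr2 : 0 ≤ K * (-t) ^ (-(1 : ℝ)) := mul_nonneg hK (Real.rpow_nonneg (neg_pos.2 ht).le _)
      have hnorm : ‖(c n * Real.sqrt (-t)) • timeDeriv (w n) t x + fderiv ℝ (w n t) x (b' n)‖ ≤ Bc := by
        have ha : ‖(c n * Real.sqrt (-t)) • timeDeriv (w n) t x‖ ≤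
            |c n| * Real.sqrt (-t) * (K * (-t) ^ (-(3 : ℝ) / 2)) := by
          rw [norm_smul, Real.norm_eq_abs, abs_mul, abs_of_nonneg (Real.sqrt_nonneg _)]
          exact mul_le_mul_of_nonneg_left (h1t n t ht x) (by positivity)
        have hb2 : ‖fderiv ℝ (w n t) x (b' n)‖ ≤ K * (-t) ^ (-(1 : ℝ)) * ‖b' n‖ :=
          (ContinuousLinearMap.le_opNorm _ _).trans
            (mul_le_mul_of_nonneg_right (h1x n t ht x) (norm_nonneg _))
        have e1 : |c n| * Real.sqrt (-t) * (K * (-t) ^ (-(3 : ℝ) / 2)) ≤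
            Mc * Real.sqrt (-t) * (K * (-t) ^ (-(3 : ℝ) / 2)) :=
          mul_le_mul_of_nonneg_right (mul_le_mul_of_nonneg_right hcn.le (Real.sqrt_nonneg _)) hr1
        have e2 : K * (-t) ^ (-(1 : ℝ)) * ‖b' n‖ ≤ K * (-t) ^ (-(1 : ℝ)) * Mb :=
          mul_le_mul_of_nonneg_left hbn.le hr2
        calc ‖(c n * Real.sqrt (-t)) • timeDeriv (w n) t x + fderiv ℝ (w n t) x (b' n)‖
            ≤ ‖(c n * Real.sqrt (-t)) • timeDeriv (w n) t x‖ + ‖fderiv ℝ (w n t) x (b' n)‖ :=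
              norm_add_le _ _
          _ ≤ Mc * Real.sqrt (-t) * (K * (-t) ^ (-(3 : ℝ) / 2)) + K * (-t) ^ (-(1 : ℝ)) * Mb :=
              add_le_add (ha.trans e1) (hb2.trans e2)
          _ = Bc := by rw [hBc]
      have hFn : ‖F n x‖ = F n x := by
        rw [Real.norm_eq_abs, abs_of_nonneg]
        exact mul_nonneg (sq_nonneg _) hexp.le
      rw [hFn, hF]
      exact mul_le_mul_of_nonneg_right (pow_le_pow_left₀ (norm_nonneg _) hnorm 2) hexp.le
    · -- pointwise convergence of the integrand
      refine Eventually.of_forall fun x => ?_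
      have hL : Tendsto (fun n => fderiv ℝ (w n t) x) atTop (𝓝 (fderiv ℝ (W t) x)) :=
        tendsto_clm_of_tendsto_apply (hfd t ht x)
      have happ : Tendsto (fun n => fderiv ℝ (w n t) x (b' n)) atTop (𝓝 (fderiv ℝ (W t) x b)) :=
        ((isBoundedBilinearMap_apply (𝕜 := ℝ) (E := EuclideanSpace ℝ (Fin 3))
          (F := EuclideanSpace ℝ (Fin 3))).continuous.tendsto (fderiv ℝ (W t) x, b)).comp
          (hL.prodMk_nhds hb)
      have hsm : Tendsto (fun n => (c n * Real.sqrt (-t)) • timeDeriv (w n) t x) atTop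
          (𝓝 ((c₀ * Real.sqrt (-t)) • timeDeriv W t x)) :=
        (hc.mul_const (Real.sqrt (-t))).smul (htd t ht x)
      have h3 : Tendsto (fun n => ‖(c n * Real.sqrt (-t)) • timeDeriv (w n) t x + fderiv ℝ (w n t) x (b' n)‖ ^ 2)
          atTop (𝓝 (‖(c₀ * Real.sqrt (-t)) • timeDeriv W t x + fderiv ℝ (W t) x b‖ ^ 2)) :=
        ((hsm.add happ).norm).pow 2
      exact h3.mul_const _
  exact hgoal.const_mul (Real.sqrt (-t))


/-- **Continuous convergence of the frame form along a limit of Type-I ancient mild fields**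
(registered sub-goal `zoomFrame_tendsto` of `stub_zoomCompactness`; closed form of
`tendsto_frame_of_limit`). -/
theorem zoomFrame_tendsto :
    ∀ (C K : ℝ) (w : ℕ → ℝ → EuclideanSpace ℝ (Fin 3) → EuclideanSpace ℝ (Fin 3)) (W : ℝ → EuclideanSpace ℝ (Fin 3) → EuclideanSpace ℝ (Fin 3)), (∀ n, Literature.Analysis.FluidPDE.IsTypeIAncientMild C (w n)) → Literature.Analysis.FluidPDE.IsTypeIAncientMild C W → (∀ t : ℝ, t < 0 → ∀ x, Filter.Tendsto (fun n => Literature.Analysis.FluidPDE.timeDeriv (w n) t x) Filter.atTop (nhds (Literature.Analysis.FluidPDE.timeDeriv W t x))) → (∀ t : ℝ, t < 0 → ∀ x e, Filter.Tendsto (fun n => fderiv ℝ (w n t) x e) Filter.atTop (nhds (fderiv ℝ (W t) x e))) → (∀ n, ∀ t : ℝ, t < 0 → ∀ x, ‖Literature.Analysis.FluidPDE.timeDeriv (w n) t x‖ ≤ K * (-t) ^ (-(3 : ℝ) / 2)) → (∀ n, ∀ t : ℝ, t < 0 → ∀ x, ‖fderiv ℝ (w n t) x‖ ≤ K * (-t)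 ^ (-(1 : ℝ))) → ∀ t : ℝ, t < 0 → ∀ (c₀ : ℝ) (b : EuclideanSpace ℝ (Fin 3)) (c : ℕ → ℝ) (b' : ℕ → EuclideanSpace ℝ (Fin 3)), Filter.Tendsto c Filter.atTop (nhds c₀) → Filter.Tendsto b' Filter.atTop (nhds b) → Filter.Tendsto (fun n => Real.sqrt (-t) * ∫ x, ‖(c n * Real.sqrt (-t)) • Literature.Analysis.FluidPDE.timeDeriv (w n) t x + fderiv ℝ ((w n) t) x (b' n)‖ ^ 2 * Real.exp (-(‖x‖ ^ 2) / (4 * (-t)))) Filter.atTop (nhds (Real.sqrt (-t) * ∫ x, ‖(c₀ * Real.sqrt (-t)) • Literature.Analysis.FluidPDE.timeDeriv W t x + fderiv ℝ (W t) x b‖ ^ 2 * Real.exp (-(‖x‖ ^ 2) / (4 * (-t))))) :=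
  fun _ _ _ _ hw hW htd hfd h1t h1x _ ht c₀ b _ _ hc hb =>
    tendsto_frame_of_limit hw hW htd hfd h1t h1x ht c₀ b hc hb

end Frame

end Summit.NavierStokesRegularity.NavierStokesRegularity.Theorems

end
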